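import Summits.AnomalousDissipation.AnomalousDissipation.Theses.TwoAndHalfD
import Literature.Analysis.FluidPDE.TwoHalfNavierStokes
import Literature.Analysis.FluidPDE.PassiveScalarForced
import Literature.Analysis.FluidPDE.DissipationAnomalyProofs
import Literature.Analysis.FluidPDE.NSStrongSolutions2DProofs
import Literature.Analysis.FluidPDE.NSUniqueness2DProofs
import Literature.Analysis.FluidPDE.SteadyNavierStokesProofs
import Literature.Analysis.FluidPDE.LerayHopfSpectralMeasurability
import Literature.Analysis.FluidPDE.NSLerayHopf
import Literature.Analysis.FunctionSpaces.TorusSobolevNormWeakDerivProofs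
import Literature.Analysis.FunctionSpaces.TorusTrigPoly
import Literature.Analysis.FunctionSpaces.TorusSpectralWeakDerivative
import Literature.Analysis.FunctionSpaces.TorusRieszFischerParam
import Literature.Analysis.FunctionSpaces.TorusSpaceTimeFields
import Literature.Analysis.FunctionSpaces.TorusVectorParseval
import Literature.Analysis.FunctionSpaces.TorusFourierCalculus

/-!
# The planar vorticity of a 2-D Leray–Hopf solution as an `L^∞_t L²_x` weak curl
(stub `stub_weakCurlWitness` of the line `log-kantorovich-enstrophy-transfer`, crux `TwoAndHalfD.TwohalfdNeg`,
stmt-AnomalousDissipation-0211)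

For `ν > 0`, a smooth steady force `g`, a datum `v₀ ∈ H¹(𝕋²)` (`MemLp v₀ 2`, `eGradNormSq v₀ < ⊤`)
and a global Leray–Hopf solution `v` of 2-D Navier–Stokes we produce (i) a mean-zero `L²` weak
curl `ω₀` of `v₀` (`∫ (∂₀χ v₀,₁ - ∂₁χ v₀,₀) = -∫ χ ω₀` for smooth `χ`; convention
`ω = ∂₀w₁ - ∂₁w₀`), and (ii) on every `(0, T)` a space–time measurable `ω`, bounded in `L²`
uniformly for a.e. `t`, which for a.e. `t` is an `L²` weak curl of `v t` with
`‖ω t‖₂² = eGradNormSq (v t)`.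

The construction is spectral. The curl coefficients of an `L²` field `w` are
`c(k) = 2πi (k₀ ŵ₁(k) - k₁ ŵ₀(k))`; when `w` is weakly divergence free, `k₀ ŵ₀ + k₁ ŵ₁ = 0`
(`Torus.IsWeaklyDivFree.sum_mul_mFourierCoeff_eq_zero`) and Lagrange's identity give
`∑ₖ ‖c(k)‖² = 4π² ∑ₖ |k|² ‖ŵ(k)‖² = eGradNormSq w` (`tsum_enorm_sq_curlCoeff`; Doering–Gibbon 1995, (1.29):
`‖∇u‖₂ = ‖ω‖₂` for periodic divergence-free fields). Riesz–Fischer (plain for the datum, parametrised in `t`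
for the solution: `Torus.exists_memLp_two_forall_mFourierCoeff_eq`, as in
`Torus.IsLerayHopfOn.exists_hasWeakGradient_holds`) synthesises an `L²` function `G` with these coefficients;
the polarised Parseval identity shows that `Re G` is a weak curl and `G` is a.e. real
(`ofReal_integral_curlTest_eq`; Grafakos 2014, Prop. 3.2.6 (8), 3.2.7 (3)), whence `‖Re G‖₂² = eGradNormSq w`.
The uniform-in-time `L²` bound is the 2-D enstrophy inequality `‖∇v(t)‖₂² ≤ ‖∇v₀‖₂² + ν⁻¹ ∫₀ᵗ ‖g‖₂²`,
valid for EVERY Leray–Hopf solution by 2-D uniqueness (`lions_prodi_uniqueness_torus2.enstrophy_regularity`,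
`lions_prodi_uniqueness_torus2_holds`, `fmrt_strong_existence_torus2_holds`; Foias–Manley–Rosa–Temam 2001,
Ch. II Thm. 7.3–7.4, (A.65)).
-/

namespace Summit.AnomalousDissipation.AnomalousDissipation.Theorems.TwohalfdNeg.WeakCurlWitness

open MeasureTheory Filter Topology
open scoped ENNReal NNReal
open Literature.Analysis.FunctionSpaces Literature.Analysis.FluidPDE

set_option linter.dupNamespace false

section Spectral

open UnitAddTorus
open scoped ComplexConjugate

/-- **Lagrange's identity for one Fourier mode.** For complex `a, b` and real `p, q` with
`p b + q a = 0` (the divergence-free relation `k · v̂(k) = 0` with `b = v̂₀(k)`, `a = v̂₁(k)`,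
`p = k₀`, `q = k₁`): `|p a - q b|² = (p² + q²)(|b|² + |a|²)`. [folklore] -/
theorem norm_sq_curlMode_eq {a b : ℂ} {p q : ℝ} (h : (p : ℂ) * b + (q : ℂ) * a = 0) :
    ‖(p : ℂ) * a - (q : ℂ) * b‖ ^ 2 = (p ^ 2 + q ^ 2) * (‖b‖ ^ 2 + ‖a‖ ^ 2) := by
  have key : ‖(p : ℂ) * a - (q : ℂ) * b‖ ^ 2 + ‖(p : ℂ) * b + (q : ℂ) * a‖ ^ 2 =
      (p ^ 2 + q ^ 2) * (‖b‖ ^ 2 + ‖a‖ ^ 2) := by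
    simp only [Complex.sq_norm, Complex.normSq_apply, Complex.sub_re, Complex.sub_im,
      Complex.mul_re, Complex.mul_im, Complex.add_re, Complex.add_im, Complex.ofReal_re,
      Complex.ofReal_im]
    ring
  rw [h, norm_zero, zero_pow two_ne_zero, add_zero] at key
  exact key

/-- **The curl coefficients of a weakly divergence-free `L²` field carry the enstrophy**:
`∑ₖ ‖2πi (k₀ ŵ₁(k) - k₁ ŵ₀(k))‖² = eGradNormSq w` (`= 4π² ∑ₖ |k|² ‖ŵ(k)‖²`), because
`k₀ ŵ₀(k) + k₁ ŵ₁(k) = 0` (`Torus.IsWeaklyDivFree.sum_mul_mFourierCoeff_eq_zero`) and Lagrange's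
identity (Doering–Gibbon 1995, (1.29): `‖∇u‖₂ = ‖ω‖₂` for periodic divergence-free fields). [folklore] -/
theorem tsum_enorm_sq_curlCoeff {w : UnitAddTorus (Fin 2) → EuclideanSpace ℝ (Fin 2)}
    (hw : MemLp w 2 volume) (hdiv : Torus.IsWeaklyDivFree w) :
    ∑' k : Fin 2 → ℤ, ‖2 * Real.pi * Complex.I *
        ((k 0 : ℂ) * mFourierCoeff (fun x => (w x 1 : ℂ)) k -
          (k 1 : ℂ) * mFourierCoeff (fun x => (w x 0 : ℂ)) k)‖ₑ ^ 2 = Torus.eGradNormSq w := by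
  have hwi : Integrable w volume := hw.integrable one_le_two
  rw [Torus.eGradNormSq_eq_tsum, ← ENNReal.tsum_mul_left]
  refine tsum_congr fun k => ?_
  set a : ℂ := mFourierCoeff (fun x => (w x 1 : ℂ)) k with ha
  set b : ℂ := mFourierCoeff (fun x => (w x 0 : ℂ)) k with hb
  have h0 : mFourierCoeff (EuclideanSpace.complexify ∘ w) k 0 = b := Torus.mFourierCoeff_complexify_apply hwi k 0
  have h1 : mFourierCoeff (EuclideanSpace.complexify ∘ w) k 1 = a := Torus.mFourierCoeff_complexify_apply hwi k 1
  -- the divergence-free relation `k₀ ŵ₀ + k₁ ŵ₁ = 0`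
  have hdivk : ((k 0 : ℝ) : ℂ) * b + ((k 1 : ℝ) : ℂ) * a = 0 := by
    have h := hdiv.sum_mul_mFourierCoeff_eq_zero hw k
    rw [Fin.sum_univ_two, h0, h1] at h
    simpa only [Complex.ofReal_intCast] using h
  -- `‖ŵ(k)‖² = ‖ŵ₀(k)‖² + ‖ŵ₁(k)‖²`
  have hnorm : ‖mFourierCoeff (EuclideanSpace.complexify ∘ w) k‖ₑ ^ 2 = ‖b‖ₑ ^ 2 + ‖a‖ₑ ^ 2 := by
    rw [Torus.enorm_sq_eq_sum_euclidean, Fin.sum_univ_two, h0, h1]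
  have hfreq : Torus.freqNormSq k = (k 0 : ℝ) ^ 2 + (k 1 : ℝ) ^ 2 := by rw [Torus.freqNormSq, Fin.sum_univ_two]
  rw [hnorm, hfreq, ← ofReal_norm, ← ENNReal.ofReal_pow (norm_nonneg _), ← ofReal_norm b,
    ← ENNReal.ofReal_pow (norm_nonneg _), ← ofReal_norm a, ← ENNReal.ofReal_pow (norm_nonneg _),
    ← ENNReal.ofReal_add (sq_nonneg _) (sq_nonneg _), ← ENNReal.ofReal_mul (by positivity),
    ← ENNReal.ofReal_mul (by positivity)]
  congr 1
  have hmode := norm_sq_curlMode_eq hdivk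
  simp only [Complex.ofReal_intCast] at hmode
  rw [norm_mul, mul_pow, hmode]
  simp only [norm_mul, Complex.norm_ofNat, Complex.norm_real, Real.norm_eq_abs, Complex.norm_I,
    mul_one, abs_of_pos Real.pi_pos]
  ring

/-- **The weak curl identity read off the Fourier side** (complex form). If
`w ∈ L²(𝕋²; ℝ²)`, `G ∈ L²(𝕋²; ℂ)` and `Ĝ(k) = 2πi (k₀ ŵ₁(k) - k₁ ŵ₀(k))` for all `k`, then for every
smooth real `χ`: `∫ ∂₀χ w₁ - ∫ ∂₁χ w₀ = -∫ χ G` (both sides are `∑ₖ conj χ̂(k) Ĝ(k)` by the polarised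
Parseval identity and `𝓕(∂ⱼχ)(k) = 2πi kⱼ χ̂(k)`; Grafakos 2014, Prop. 3.2.6 (8), Prop. 3.2.7 (3)). [folklore] -/
theorem ofReal_integral_curlTest_eq {w : UnitAddTorus (Fin 2) → EuclideanSpace ℝ (Fin 2)}
    (hw : MemLp w 2 volume) {G : UnitAddTorus (Fin 2) → ℂ} (hG : MemLp G 2 volume)
    (hcoeff : ∀ k : Fin 2 → ℤ, mFourierCoeff G k = 2 * Real.pi * Complex.I *
      ((k 0 : ℂ) * mFourierCoeff (fun x => (w x 1 : ℂ)) k -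
        (k 1 : ℂ) * mFourierCoeff (fun x => (w x 0 : ℂ)) k))
    {χ : UnitAddTorus (Fin 2) → ℝ} (hχ : Torus.IsSmooth χ) :
    (((∫ x, Torus.partialDeriv 0 χ x * w x 1) - ∫ x, Torus.partialDeriv 1 χ x * w x 0 : ℝ) : ℂ) =
      -∫ x, (χ x : ℂ) * G x := by
  have hΦ : Torus.IsSmooth (fun x => (χ x : ℂ)) := hχ.ofReal_comp
  have hdΦ : ∀ j, Torus.partialDeriv j (fun y => (χ y : ℂ)) = fun x => ((Torus.partialDeriv j χ x : ℝ) : ℂ) :=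
    fun j => funext (Torus.partialDeriv_ofReal_comp hχ j)
  have hwC : ∀ j, MemLp (fun x => (w x j : ℂ)) 2 volume := fun j =>
    Complex.ofRealCLM.comp_memLp' (hw.eval_piLp j)
  -- polarised Parseval for the pairs `(∂ⱼχ, wᵢ)`
  have hpair : ∀ j i, HasSum (fun k : Fin 2 → ℤ =>
      conj (mFourierCoeff (Torus.partialDeriv j (fun y => (χ y : ℂ))) k) *
        mFourierCoeff (fun x => (w x i : ℂ)) k)
      ((∫ x, Torus.partialDeriv j χ x * w x i : ℝ) : ℂ) := by
    intro j i
    have h := Torus.hasSum_conj_mul_mFourierCoeff ((hΦ.partialDeriv j).memLp 2) (hwC i)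
    have hval : ∫ x, conj (Torus.partialDeriv j (fun y => (χ y : ℂ)) x) * (w x i : ℂ) =
        ((∫ x, Torus.partialDeriv j χ x * w x i : ℝ) : ℂ) := by
      rw [← integral_complex_ofReal]
      refine integral_congr_ae (ae_of_all _ fun x => ?_)
      simp [hdΦ]
    rwa [hval] at h
  have h1 := (hpair 0 1).sub (hpair 1 0)
  -- polarised Parseval for the pair `(χ, G)`
  have h2 := (Torus.hasSum_conj_mul_mFourierCoeff (hΦ.memLp 2) hG).neg
  have hval2 : ∫ x, conj ((χ x : ℂ)) * G x = ∫ x, (χ x : ℂ) * G x := by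
    refine integral_congr_ae (ae_of_all _ fun x => ?_)
    simp [Complex.conj_ofReal]
  rw [hval2] at h2
  rw [Complex.ofReal_sub]
  refine h1.unique (h2.congr_fun fun k => ?_)
  dsimp only
  rw [hcoeff k, Torus.mFourierCoeff_partialDeriv hΦ 0 k, Torus.mFourierCoeff_partialDeriv hΦ 1 k]
  simp only [smul_eq_mul, map_mul, Complex.conj_ofReal, Complex.conj_I, map_intCast, map_ofNat]
  ring

/-- Real parts of `ofReal_integral_curlTest_eq`: **`Re G` is a weak curl of `w`**,
`∫ (∂₀χ w₁ - ∂₁χ w₀) = -∫ χ Re G` for every smooth real `χ`. [folklore] -/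
theorem integral_curlTest_eq_neg_integral_mul_re {w : UnitAddTorus (Fin 2) → EuclideanSpace ℝ (Fin 2)}
    (hw : MemLp w 2 volume) {G : UnitAddTorus (Fin 2) → ℂ} (hG : MemLp G 2 volume)
    (hcoeff : ∀ k : Fin 2 → ℤ, mFourierCoeff G k = 2 * Real.pi * Complex.I *
      ((k 0 : ℂ) * mFourierCoeff (fun x => (w x 1 : ℂ)) k -
        (k 1 : ℂ) * mFourierCoeff (fun x => (w x 0 : ℂ)) k))
    {χ : UnitAddTorus (Fin 2) → ℝ} (hχ : Torus.IsSmooth χ) :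
    ∫ x, (Torus.partialDeriv 0 χ x * w x 1 - Torus.partialDeriv 1 χ x * w x 0) =
      -∫ x, χ x * (G x).re := by
  have hwi : Integrable w volume := hw.integrable one_le_two
  have hint : ∀ j i, Integrable (fun x => Torus.partialDeriv j χ x * w x i) volume := fun j i =>
    (hχ.partialDeriv j).integrable_smul (hwi.eval_piLp i)
  rw [integral_sub (hint 0 1) (hint 1 0)]
  have h := congrArg Complex.re (ofReal_integral_curlTest_eq hw hG hcoeff hχ)
  have hintC : Integrable (fun x => (χ x : ℂ) * G x) volume := by
    have := hχ.integrable_smul (hG.integrable one_le_two)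
    simpa [Complex.real_smul] using this
  rw [Complex.ofReal_re, Complex.neg_re, ← RCLike.re_eq_complex_re, ← integral_re hintC] at h
  rw [h]
  congr 1
  refine integral_congr_ae (ae_of_all _ fun x => ?_)
  simp

/-- Imaginary parts of `ofReal_integral_curlTest_eq`: `∫ χ Im G = 0` for every smooth real `χ`,
hence **`G` is a.e. real** (`Torus.ae_eq_zero_of_forall_integral_mul_eq_zero`). [folklore] -/
theorem im_ae_eq_zero_of_curlCoeff {w : UnitAddTorus (Fin 2) → EuclideanSpace ℝ (Fin 2)}
    (hw : MemLp w 2 volume) {G : UnitAddTorus (Fin 2) → ℂ} (hG : MemLp G 2 volume)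
    (hcoeff : ∀ k : Fin 2 → ℤ, mFourierCoeff G k = 2 * Real.pi * Complex.I *
      ((k 0 : ℂ) * mFourierCoeff (fun x => (w x 1 : ℂ)) k -
        (k 1 : ℂ) * mFourierCoeff (fun x => (w x 0 : ℂ)) k)) :
    (fun x => (G x).im) =ᵐ[volume] 0 := by
  refine Torus.ae_eq_zero_of_forall_integral_mul_eq_zero (Complex.imCLM.comp_memLp' hG) fun φ hφ => ?_
  have h := congrArg Complex.im (ofReal_integral_curlTest_eq hw hG hcoeff hφ)
  have hint : Integrable (fun x => (φ x : ℂ) * G x) volume := by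
    have := hφ.integrable_smul (hG.integrable one_le_two)
    simpa [Complex.real_smul] using this
  rw [Complex.ofReal_im, Complex.neg_im, ← RCLike.im_eq_complex_im, ← integral_im hint, eq_comm, neg_eq_zero] at h
  rw [← h]
  refine integral_congr_ae (ae_of_all _ fun x => ?_)
  simp

/-- **The `L²` mass of the weak curl is the enstrophy**: under the hypotheses of
`ofReal_integral_curlTest_eq` and if `w` is weakly divergence free,
`‖Re G‖₂² = eGradNormSq w` (in `[0, ∞]`): `G` is a.e. real, Parseval, and
`tsum_enorm_sq_curlCoeff`. [folklore] -/
theorem ofReal_scalarL2Sq_re_eq_eGradNormSq {w : UnitAddTorus (Fin 2) → EuclideanSpace ℝ (Fin 2)}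
    (hw : MemLp w 2 volume) (hdiv : Torus.IsWeaklyDivFree w)
    {G : UnitAddTorus (Fin 2) → ℂ} (hG : MemLp G 2 volume)
    (hcoeff : ∀ k : Fin 2 → ℤ, mFourierCoeff G k = 2 * Real.pi * Complex.I *
      ((k 0 : ℂ) * mFourierCoeff (fun x => (w x 1 : ℂ)) k -
        (k 1 : ℂ) * mFourierCoeff (fun x => (w x 0 : ℂ)) k)) :
    ENNReal.ofReal (Torus.scalarL2Sq fun x => (G x).re) = Torus.eGradNormSq w := by
  have hre : (fun x => (G x).re ^ 2) =ᵐ[volume] fun x => ‖G x‖ ^ 2 := by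
    filter_upwards [im_ae_eq_zero_of_curlCoeff hw hG hcoeff] with x hx
    simp only [Pi.zero_apply] at hx
    rw [Complex.sq_norm, Complex.normSq_apply, hx]
    ring
  have hP : ∑' k : Fin 2 → ℤ, ‖mFourierCoeff G k‖ₑ ^ 2 = Torus.eGradNormSq w := by
    rw [← tsum_enorm_sq_curlCoeff hw hdiv]
    exact tsum_congr fun k => by rw [hcoeff k]
  rw [Torus.scalarL2Sq, integral_congr_ae hre, ← hP, Torus.tsum_enorm_sq_mFourierCoeff hG,
    ofReal_integral_eq_lintegral_ofReal (hG.integrable_norm_pow two_ne_zero)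
      (ae_of_all _ fun x => by positivity)]
  refine lintegral_congr fun x => ?_
  rw [← ofReal_norm, ← ENNReal.ofReal_pow (norm_nonneg _)]

/-- For a real `L²` function, `∫⁻ ‖f‖ₑ² = ofReal ‖f‖₂²` (`Torus.scalarL2Sq f = ∫ f²`). [folklore] -/
theorem lintegral_enorm_sq_eq_ofReal_scalarL2Sq {f : UnitAddTorus (Fin 2) → ℝ} (hf : MemLp f 2 volume) :
    ∫⁻ x, ‖f x‖ₑ ^ 2 = ENNReal.ofReal (Torus.scalarL2Sq f) := by
  rw [Torus.scalarL2Sq, ofReal_integral_eq_lintegral_ofReal hf.integrable_sq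
    (ae_of_all _ fun x => sq_nonneg _)]
  refine lintegral_congr fun x => ?_
  rw [← sq_abs, ENNReal.ofReal_pow (abs_nonneg _), ← Real.enorm_eq_ofReal_abs]

end Spectral

section Witness

open UnitAddTorus

/-- **A weakly divergence-free `H¹` field on `𝕋²` has a mean-zero `L²` weak curl**: if
`v₀ ∈ L²`, `eGradNormSq v₀ < ∞` and `v₀` is weakly divergence free, then there is `ω₀ ∈ L²`,
`∫ ω₀ = 0`, with `∫ (∂₀χ v₀,₁ - ∂₁χ v₀,₀) = -∫ χ ω₀` for all smooth `χ`. The curl coefficients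
`2πi (k₀ v̂₁ - k₁ v̂₀)` are square summable (`tsum_enorm_sq_curlCoeff`), Riesz–Fischer
(`Torus.exists_memLp_two_forall_mFourierCoeff_eq_of_summable`) synthesises `G ∈ L²` with these
coefficients, `ω₀ = Re G` (`integral_curlTest_eq_neg_integral_mul_re`); mean zero by testing with
`χ = 1`. [folklore] -/
theorem exists_weakCurl_datum {v₀ : UnitAddTorus (Fin 2) → EuclideanSpace ℝ (Fin 2)}
    (hv₀ : MemLp v₀ 2 volume) (hgrad : Torus.eGradNormSq v₀ < ⊤) (hdiv : Torus.IsWeaklyDivFree v₀) :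
    ∃ ω₀ : UnitAddTorus (Fin 2) → ℝ, MemLp ω₀ 2 volume ∧ (∫ x, ω₀ x = 0) ∧
      ∀ χ : UnitAddTorus (Fin 2) → ℝ, Torus.IsSmooth χ →
        ∫ x, (Torus.partialDeriv 0 χ x * v₀ x 1 - Torus.partialDeriv 1 χ x * v₀ x 0) =
          -∫ x, χ x * ω₀ x := by
  set a : (Fin 2 → ℤ) → ℂ := fun k => 2 * Real.pi * Complex.I *
    ((k 0 : ℂ) * mFourierCoeff (fun x => (v₀ x 1 : ℂ)) k -
      (k 1 : ℂ) * mFourierCoeff (fun x => (v₀ x 0 : ℂ)) k) with ha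
  have hfin : ∑' k, ‖a k‖ₑ ^ 2 < ∞ := by
    rw [ha, tsum_enorm_sq_curlCoeff hv₀ hdiv]
    exact hgrad
  have hsum : Summable fun k => ‖a k‖ ^ 2 := by
    simpa using ENNReal.summable_toReal hfin.ne
  obtain ⟨G, hG2, hGc⟩ := Torus.exists_memLp_two_forall_mFourierCoeff_eq_of_summable hsum
  have hcurl : ∀ χ : UnitAddTorus (Fin 2) → ℝ, Torus.IsSmooth χ →
      ∫ x, (Torus.partialDeriv 0 χ x * v₀ x 1 - Torus.partialDeriv 1 χ x * v₀ x 0) =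
        -∫ x, χ x * (G x).re :=
    fun χ hχ => integral_curlTest_eq_neg_integral_mul_re hv₀ hG2 hGc hχ
  refine ⟨fun x => (G x).re, Complex.reCLM.comp_memLp' hG2, ?_, hcurl⟩
  -- mean zero: test with `χ = 1`
  have h1 := hcurl (fun _ => (1 : ℝ)) (Torus.isSmooth_const (1 : ℝ))
  have h0 : ∀ j x, Torus.partialDeriv j (fun _ : UnitAddTorus (Fin 2) => (1 : ℝ)) x = 0 :=
    fun j x => by simp [Torus.partialDeriv, Torus.lineDeriv]
  simp only [h0, zero_mul, sub_zero, integral_zero, one_mul] at h1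
  exact neg_eq_zero.1 h1.symm

variable {T ν : ℝ} {f v : ℝ → UnitAddTorus (Fin 2) → EuclideanSpace ℝ (Fin 2)}
  {v₀ : UnitAddTorus (Fin 2) → EuclideanSpace ℝ (Fin 2)}

/-- **The vorticity of a 2-D Leray–Hopf solution with bounded enstrophy, as a jointly measurable
`L^∞_t L²_x` weak curl.** If `v` is Leray–Hopf on `[0, T)` and `eGradNormSq (v t) ≤ B < ∞` on
`(0, T)`, then there is `ω : ℝ → 𝕋² → ℝ`, space–time measurable on `(0,T) × ℝ²`, with
`∫ ‖ω t‖² ≤ B` for a.e. `t ∈ (0,T)`, and for a.e. `t`: `ω t ∈ L²` is a weak curl of `v t` and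
`‖ω t‖₂² = eGradNormSq (v t)`. Proof: the curl coefficients `c(t, k) = 2πi (k₀ v̂₁(t,k) - k₁ v̂₀(t,k))` are
measurable in `t` (`Torus.aestronglyMeasurable_mFourierCoeff_slice`) with `∑ₖ ‖c(t,k)‖² = eGradNormSq (v t)`
for a.e. `t` (`tsum_enorm_sq_curlCoeff`, `v t` weakly divergence free a.e.), integrable on `(0, T)`
(`Torus.IsLerayHopfOn.lintegral_eGradNormSq_lt_top`); the parametrised Riesz–Fischer theorem
`Torus.exists_memLp_two_forall_mFourierCoeff_eq` gives a jointly measurable `G` with these slice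
coefficients, and `ω = Re G` (Temam 1984, Ch. III §1.1; Evans 2010, §5.9.2). [folklore] -/
theorem exists_weakCurl_of_isLerayHopfOn (h : Torus.IsLerayHopfOn T ν f v₀ v) {B : ℝ≥0∞}
    (hB : B ≠ ⊤) (hbound : ∀ t ∈ Set.Ioo 0 T, Torus.eGradNormSq (v t) ≤ B) :
    ∃ ω : ℝ → UnitAddTorus (Fin 2) → ℝ,
      AEStronglyMeasurable (Torus.stLift ω) (volume.restrict (Set.Ioo 0 T ×ˢ Set.univ)) ∧
      (∃ C : ℝ≥0, ∀ᵐ t ∂(volume.restrict (Set.Ioo 0 T)), ∫⁻ x, ‖ω t x‖ₑ ^ 2 ≤ C) ∧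
      ∀ᵐ t ∂(volume.restrict (Set.Ioo 0 T)),
        MemLp (ω t) 2 volume ∧
        (∀ χ : UnitAddTorus (Fin 2) → ℝ, Torus.IsSmooth χ →
          ∫ x, (Torus.partialDeriv 0 χ x * v t x 1 - Torus.partialDeriv 1 χ x * v t x 0) =
            -∫ x, χ x * ω t x) ∧
        ENNReal.ofReal (Torus.scalarL2Sq (ω t)) = Torus.eGradNormSq (v t) := by
  set μ : Measure ℝ := volume.restrict (Set.Ioo 0 T) with hμ
  -- joint measurability of `v` on `(0, T) × 𝕋²`
  have hU : AEStronglyMeasurable (Function.uncurry v) (μ.prod volume) := by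
    have h1 := Torus.aestronglyMeasurable_uncurry_of_stLift_restrict h.weak.1
    rwa [Measure.volume_eq_prod, ← Measure.prod_restrict, Measure.restrict_univ] at h1
  have hLp : ∀ᵐ t ∂μ, MemLp (v t) 2 volume :=
    (ae_restrict_iff' measurableSet_Ioo).2
      (ae_of_all _ fun t ht => h.memLp t (Set.Ioo_subset_Icc_self ht))
  have hdiv : ∀ᵐ t ∂μ, Torus.IsWeaklyDivFree (v t) := h.weak.ae_isWeaklyDivFree
  -- the curl coefficients
  set c : ℝ → (Fin 2 → ℤ) → ℂ := fun t k => 2 * Real.pi * Complex.I *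
    ((k 0 : ℂ) * mFourierCoeff (fun x => (v t x 1 : ℂ)) k -
      (k 1 : ℂ) * mFourierCoeff (fun x => (v t x 0 : ℂ)) k) with hc_def
  have hc : ∀ k, AEStronglyMeasurable (fun t => c t k) μ := fun k =>
    aestronglyMeasurable_const.mul
      ((aestronglyMeasurable_const.mul (Torus.aestronglyMeasurable_mFourierCoeff_slice hU 1 k)).sub
        (aestronglyMeasurable_const.mul (Torus.aestronglyMeasurable_mFourierCoeff_slice hU 0 k)))
  have hcsum : ∀ᵐ t ∂μ, ∑' k, ‖c t k‖ₑ ^ 2 = Torus.eGradNormSq (v t) := by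
    filter_upwards [hLp, hdiv] with t ht hdt
    exact tsum_enorm_sq_curlCoeff ht hdt
  have hC : ∫⁻ t, ∑' k, ‖c t k‖ₑ ^ 2 ∂μ ≠ ∞ := by
    rw [lintegral_congr_ae hcsum]
    exact h.lintegral_eGradNormSq_lt_top.ne
  -- parametrised Riesz–Fischer
  obtain ⟨G, hGm, hG⟩ := Torus.exists_memLp_two_forall_mFourierCoeff_eq hc hC
  set ω : ℝ → UnitAddTorus (Fin 2) → ℝ := fun t x => (G t x).re with hω
  have hae : ∀ᵐ t ∂μ, MemLp (ω t) 2 volume ∧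
      (∀ χ : UnitAddTorus (Fin 2) → ℝ, Torus.IsSmooth χ →
        ∫ x, (Torus.partialDeriv 0 χ x * v t x 1 - Torus.partialDeriv 1 χ x * v t x 0) =
          -∫ x, χ x * ω t x) ∧
      ENNReal.ofReal (Torus.scalarL2Sq (ω t)) = Torus.eGradNormSq (v t) := by
    filter_upwards [hLp, hdiv, hG] with t ht hdt hGt
    obtain ⟨hGt2, hGc⟩ := hGt
    exact ⟨Complex.reCLM.comp_memLp' hGt2,
      fun χ hχ => integral_curlTest_eq_neg_integral_mul_re ht hGt2 hGc hχ,
      ofReal_scalarL2Sq_re_eq_eGradNormSq ht hdt hGt2 hGc⟩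
  refine ⟨ω, ?_, ⟨B.toNNReal, ?_⟩, hae⟩
  · -- joint measurability, transferred to the space–time lift
    have h1 : AEStronglyMeasurable (Function.uncurry ω) (μ.prod volume) :=
      Complex.continuous_re.comp_aestronglyMeasurable hGm
    exact Torus.aestronglyMeasurable_stLift_of_uncurry h1
  · -- the uniform `L²` bound
    filter_upwards [hae, ae_restrict_mem measurableSet_Ioo] with t ht htm
    rw [lintegral_enorm_sq_eq_ofReal_scalarL2Sq ht.1, ht.2.2, ENNReal.coe_toNNReal hB]
    exact hbound t htm

end Witness

/-- **S6-co/W `stub_weakCurlWitness`.** For `ν > 0`, a smooth steady force `g`, a datum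
`v₀ ∈ H¹` (`MemLp v₀ 2`, `eGradNormSq v₀ < ⊤`) and a global Leray–Hopf solution `v` on `𝕋²`:
(i) a mean-zero `L²` weak curl `ω₀` of `v₀` (`exists_weakCurl_datum`, the datum being weakly
divergence free by `Torus.IsGlobalLerayHopf.isWeaklyDivFree_datum`); (ii) on every `(0, T)` a
space–time measurable weak curl `ω` of `v`, bounded in `L²` uniformly for a.e. `t`, with
`‖ω t‖₂² = eGradNormSq (v t)` (`exists_weakCurl_of_isLerayHopfOn`), the uniform enstrophy bound
`eGradNormSq (v t) ≤ eGradNormSq v₀ + ν⁻¹ ∫₀ᵀ ‖g‖₂²` being the 2-D enstrophy inequality transferred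
to every Leray–Hopf solution (`lions_prodi_uniqueness_torus2.enstrophy_regularity` with
`lions_prodi_uniqueness_torus2_holds`, `fmrt_strong_existence_torus2_holds`; Foias–Manley–Rosa–Temam
2001, Ch. II Thm. 7.3–7.4, (A.65)). -/
theorem stub_weakCurlWitness :
    ∀ (ν : ℝ) (g : UnitAddTorus (Fin 2) → EuclideanSpace ℝ (Fin 2)),
      0 < ν → Torus.IsSmooth g → Torus.IsDivFree g → Torus.HasZeroMean g →
      ∀ (v₀ : UnitAddTorus (Fin 2) → EuclideanSpace ℝ (Fin 2))
        (v : ℝ → UnitAddTorus (Fin 2) → EuclideanSpace ℝ (Fin 2)),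
        MemLp v₀ 2 volume → Torus.eGradNormSq v₀ < ⊤ →
        Torus.IsGlobalLerayHopf ν (fun _ => g) v₀ v →
        (∃ ω₀ : UnitAddTorus (Fin 2) → ℝ, MemLp ω₀ 2 volume ∧ (∫ x, ω₀ x = 0) ∧
          ∀ χ : UnitAddTorus (Fin 2) → ℝ, Torus.IsSmooth χ →
            ∫ x, (Torus.partialDeriv 0 χ x * v₀ x 1 - Torus.partialDeriv 1 χ x * v₀ x 0) =
              -∫ x, χ x * ω₀ x) ∧
        ∀ T : ℝ, 0 < T → ∃ ω : ℝ → UnitAddTorus (Fin 2) → ℝ,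
          AEStronglyMeasurable (Torus.stLift ω) (volume.restrict (Set.Ioo 0 T ×ˢ Set.univ)) ∧
          (∃ C : ℝ≥0, ∀ᵐ t ∂(volume.restrict (Set.Ioo 0 T)), ∫⁻ x, ‖ω t x‖ₑ ^ 2 ≤ C) ∧
          ∀ᵐ t ∂(volume.restrict (Set.Ioo 0 T)),
            MemLp (ω t) 2 volume ∧
            (∀ χ : UnitAddTorus (Fin 2) → ℝ, Torus.IsSmooth χ →
              ∫ x, (Torus.partialDeriv 0 χ x * v t x 1 - Torus.partialDeriv 1 χ x * v t x 0) =
                -∫ x, χ x * ω t x) ∧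
            ENNReal.ofReal (Torus.scalarL2Sq (ω t)) = Torus.eGradNormSq (v t) := by
  intro ν g hν hg _ _ v₀ v hv₀ hgrad hLH
  have hdiv₀ : Torus.IsWeaklyDivFree v₀ := hLH.isWeaklyDivFree_datum
  refine ⟨exists_weakCurl_datum hv₀ hgrad hdiv₀, fun T hT => ?_⟩
  -- the 2-D enstrophy inequality, transferred to the Leray–Hopf solution `v`
  have hv₀H1 : Torus.MemSobolev 1 (EuclideanSpace.complexify ∘ v₀) :=
    Torus.memSobolev_one_complexify_of_eGradNormSq_ne_top hv₀ hgrad.ne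
  have hfm := aestronglyMeasurable_stLift_const hg
    (volume.restrict (Set.Ioi (0 : ℝ) ×ˢ (Set.univ : Set (EuclideanSpace ℝ (Fin 2)))))
  have hf₂ : ∀ T' : ℝ, 0 < T' → ∫⁻ _ in Set.Ioo 0 T', ∫⁻ x, ‖g x‖ₑ ^ 2 < ∞ := fun T' _ =>
    lintegral_enorm_sq_const_lt_top hg T'
  obtain ⟨-, hEns⟩ := lions_prodi_uniqueness_torus2.enstrophy_regularity
    lions_prodi_uniqueness_torus2_holds fmrt_strong_existence_torus2_holds hν hv₀H1 hdiv₀ hfm hf₂ hLH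
  set B : ℝ≥0∞ := Torus.eGradNormSq v₀ +
    ENNReal.ofReal ν⁻¹ * ∫⁻ _ in Set.Ioo 0 T, ∫⁻ x, ‖g x‖ₑ ^ 2 with hB_def
  have hB : B ≠ ⊤ := ENNReal.add_ne_top.2
    ⟨hgrad.ne, ENNReal.mul_ne_top ENNReal.ofReal_ne_top (hf₂ T hT).ne⟩
  have hbound : ∀ t ∈ Set.Ioo 0 T, Torus.eGradNormSq (v t) ≤ B := by
    intro t ht
    calc Torus.eGradNormSq (v t)
        ≤ Torus.eGradNormSq (v t) + ENNReal.ofReal ν * ∫⁻ s in Set.Ioo 0 t, eLaplacianNormSq (v s) :=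
          le_self_add
      _ ≤ Torus.eGradNormSq v₀ + ENNReal.ofReal ν⁻¹ * ∫⁻ _ in Set.Ioo 0 t, ∫⁻ x, ‖g x‖ₑ ^ 2 :=
          hEns t ht.1
      _ ≤ B := add_le_add_right (mul_le_mul_right
          (lintegral_mono_set (Set.Ioo_subset_Ioo le_rfl ht.2.le)) _) _
  exact exists_weakCurl_of_isLerayHopfOn (hLH T hT) hB hbound

end Summit.AnomalousDissipation.AnomalousDissipation.Theorems.TwohalfdNeg.WeakCurlWitness
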